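import Summits.QuantumFields.YangMills.Theses.UnitScaleTilt
import Literature.MathematicalPhysics.QuantumFieldTheory.Balaban1983to89.T3MinimiserStabilityReduction

/-!
# Route `UnitScaleTilt` — child K1a `MinimiserStability` (stmt-QuantumFields-19822) REDUCED TO THREE ONE-STEP SCHEMAS ALONG MINIMISERS
# (support file; the item stays open)

Cell `ym3-torus` (HUMAN RULING D-0037, YM ladder rung R3), seat `ym3-torus-p1` gen 4.  `unitScaleTilt_minimiserStability_of_alongMinimisers`:
`MinimiserStability` ⇐ for every `L`, eventually in `m`, for every profile and all small `γ`, the three schemas of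
`T3MinimiserStabilityReduction` — `HasMinimisersAt` (the constrained minima of runs `K`, `K+1` over the fibres of every small datum are
attained; [Balaban1985Variational] Thm 1 for the regular space), `UpperAlongMinimisersAt` (one-step interpolation bound along run-`K`
minimisers: the cell's INTERP node), `LowerAlongMinimisersAt` (one-step averaging bound along run-`(K+1)` minimisers: the cell's
AVG-INEQ node, [Federbush1987PhaseCellIII] Thm 4.3 in kind) — composed by `minimiserStabilityAt_of_alongMinimisers` (κ ≡ 0; the
constants of `MinimiserStabilityAt` are idle, `minimiserStabilityAt_iff_constFree`).  A K1a line may register exactly these three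
as stubs.  NOT a proof of K1a.
-/

noncomputable section

open Literature.MathematicalPhysics.QuantumFieldTheory.Balaban1983to89
open Literature.MathematicalPhysics.QuantumFieldTheory.Balaban1983to89.T3ContinuumYM3Torus
open Literature.MathematicalPhysics.QuantumFieldTheory.Balaban1983to89.T3MinimiserStabilityReduction
open Summit.QuantumFields.YangMills.Theses.UnitScaleTilt

namespace Summit.QuantumFields.YangMills.Theorems

/-- **K1a ⇐ THREE SCHEMAS ALONG MINIMISERS** under the item's quantifier prefix (`∀ L, ∃ m₀, ∀ m ≥ m₀, ∀ profile, ∃ γ₁, ∀ F γ ≤ γ₁`):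
existence of the constrained minimisers ∧ the one-step upper bound along run-`K` minimisers ∧ the one-step lower bound along
run-`(K+1)` minimisers ⇒ `MinimiserStability` (`0 < γ` gives the `0 ≤ γ` the reduction needs). -/
theorem unitScaleTilt_minimiserStability_of_alongMinimisers
    (h : ∀ L : ℕ, ∃ m₀ : ℕ, ∀ m : ℕ, m₀ ≤ m → ∀ b₀ p₀ : ℝ, 0 < b₀ → 2 < p₀ → ∃ γ₁ : ℝ, 0 < γ₁ ∧
      ∀ (F : T3Family) (γ : ℝ), F.L = L → 0 < γ → γ ≤ γ₁ →
        HasMinimisersAt F γ b₀ p₀ m ∧ UpperAlongMinimisersAt F γ b₀ p₀ m ∧ LowerAlongMinimisersAt F γ b₀ p₀ m) :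
    MinimiserStability := by
  intro L
  obtain ⟨m₀, h⟩ := h L
  refine ⟨m₀, fun m hm b₀ p₀ hb hp => ?_⟩
  obtain ⟨γ₁, hγ₁, h⟩ := h m hm b₀ p₀ hb hp
  refine ⟨γ₁, hγ₁, fun F γ hL hγ hle => ?_⟩
  obtain ⟨hex, hup, hlow⟩ := h F γ hL hγ hle
  exact minimiserStabilityAt_of_alongMinimisers F hγ.le hex hup hlow

/-- The constant-free reading of the item: `MinimiserStability` ⇐ the same prefix over `MinimiserStabilityFreeAt` (κ ≡ 0). -/
theorem unitScaleTilt_minimiserStability_of_constFree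
    (h : ∀ L : ℕ, ∃ m₀ : ℕ, ∀ m : ℕ, m₀ ≤ m → ∀ b₀ p₀ : ℝ, 0 < b₀ → 2 < p₀ → ∃ γ₁ : ℝ, 0 < γ₁ ∧
      ∀ (F : T3Family) (γ : ℝ), F.L = L → 0 < γ → γ ≤ γ₁ → MinimiserStabilityFreeAt F γ b₀ p₀ m) :
    MinimiserStability := by
  intro L
  obtain ⟨m₀, h⟩ := h L
  refine ⟨m₀, fun m hm b₀ p₀ hb hp => ?_⟩
  obtain ⟨γ₁, hγ₁, h⟩ := h m hm b₀ p₀ hb hp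
  exact ⟨γ₁, hγ₁, fun F γ hL hγ hle => minimiserStabilityAt_of_constFree F (h F γ hL hγ hle)⟩

end Summit.QuantumFields.YangMills.Theorems

end
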